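import Summits.ResolutionOfSingularities.ResolutionOfSingularities.Theorems.FrobeniusClosingSteerVisitLawClord
import Summits.ResolutionOfSingularities.ResolutionOfSingularities.Theorems.FrobeniusClosingSteerVisitLawExcClord
import Summits.ResolutionOfSingularities.ResolutionOfSingularities.Theorems.FrobeniusClosingSteerCleaningOptimalOfIsolated

/-!
# Crux `Steer` (stmt-ResolutionOfSingularities-16345), chain W4.1, (Par-S) hARᵒ S1a — FILE 2b CLOSING: the repaired visit law of a run
# (res-type-062 g15; res-L0-w41-plan-1 RULING 145 (R1/R2) / 156c FILE 2b; over res-type-096's (α) `VisitLaw.clord_exc_of_pointStep` p537842,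
# `VisitLawTelescope` p539396 and `VisitLawClord` p541743; Theses-free support)

OURS (campaign `res-hironaka`, rung L ★L-G4, slot W4.1; statements about the route's own objects — a σ_top-steered run `IsSteeredRun O R P t 2 s`
and the member-datum words `HasCleanedOrderAt` / `HasClordAlongAt` / `IsVisitPair` of `…Words12MemberDatum`; they replace the role of no printed item and
are NOT statements of the manuscript under review [claim: Hironaka2017, status: under-review]; AI review is weaker than expert review).
Seat res-type-062 g15. Definition-free; no Theses file is imported.

## What is proved (characteristic `2`, `R 0` dominated by `O`)

* `hasClordAlongAt_succ_of_pointStep` — **(hstart)** at a POINT step `j` with regular member, exceptional parameter `x` and cleaned order EXACTLY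
  `ν ≥ 2`, the clord of the member along `x` at stage `j+1` is EXACTLY `ν − 2`: res-type-096's (α) `VisitLaw.clord_exc_of_pointStep` read through
  `DivisorTrigger.eq_locAtCentre_blowupRing` (the next member IS the chart local ring at the exceptional parameter of the step) and associate-invariance
  (`VisitLawClord.hasClordAlongAt_of_associated`; the step's own parameter is a unit multiple of `x`, `VisitLawTelescope.excParam_eq_unit_mul`).
* `span_image_maximalIdeal_eq` / `prime_excParam_succ` — after a point step between REGULAR members the exceptional parameter `x` generates the extended
  maximal ideal, lies in `𝔪 ∖ 𝔪²` of the new member (`CleaningOptimal.excParam_mem_and_not_mem_sq`) and is therefore PRIME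
  (`SigmaTopLegality.isPrime_span_singleton_of_not_mem_sq`).
* `two_le_clord_of_strip` / `two_le_clord_between` — **weak strip legality is free**: at a NON-point step whose centre is the strip `(x)`, the σ_top
  centre is permissible, so `f − g² ∈ (x)²` for some `g`, whence any clord along `x` there is `≥ 2`.
* **`visitLaw₂_of_pieces`** — the REPAIRED one-step law between two visits (plan-1 RULING 145 R1/R2, unit cofactor, hypothesis Hγ «only `x`-strips in
  between») with the COUNT: for a visit pair `(j, j′)`, `x` exceptional at `j`, cleaned order `ν ≥ 2` at `j`, members `R j`, `R (j+1)` regular, and (δ)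
  «at the point step `j′` the clord along `x` is `≤ 1`» (res-type-072's slot): `R j′ = R (j+1)`,
  `s j′ · x ^ (ν / 2) · W = s j − G` with `G, W, W⁻¹ ∈ R j′`, `W ≠ 0`, `j′ − j = ν / 2`, and the clord along `x` at `j′` is `ν % 2`
  (clauses 1–4 of tri-1's `VisitLawAt` in the repaired currency; the input shape of `ArithReductionLegality.H3_of_pieces`).

[folklore]
-/

-- `Summit.<S>.<S>.…` duplicates the summit name by design (single-problem summit).
set_option linter.dupNamespace false

open IsLocalRing
open Literature.AlgebraicGeometry.Resolution (SubringDominates IsLocalBlowupAlong IsQuadraticTransformAlong locAtCentre blowupRing)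

namespace Summit.ResolutionOfSingularities.ResolutionOfSingularities.Theorems.SwitchingDichotomy

namespace VisitLawPointStep

open Summit.ResolutionOfSingularities.ResolutionOfSingularities.Theorems.SwitchingDichotomy.Words
  (HasClordAlongAt HasCleanedOrderAt IsSteeredRun IsVisitPair IsPointStep)

variable {K : Type} [Field K] {O : ValuationSubring K} {R : ℕ → Subring K} {P : (i : ℕ) → Ideal (R i)} {t : K} {s : ℕ → K}

/-! ## §0 Run bookkeeping -/

/-- The blow-up word of every step of a steered run. [folklore] -/
theorem isLocalBlowupAlong_of_run {p : ℕ} (hrun : IsSteeredRun O R P t p s) (i : ℕ) :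
    IsLocalBlowupAlong O (R i) (P i) (R (i + 1)) := by
  obtain ⟨_, _, -, h, -⟩ := hrun.2 i
  exact h

/-- The strict-transform word of every step of a steered run. [folklore] -/
theorem step_of_run {p : ℕ} (hrun : IsSteeredRun O R P t p s) (i : ℕ) :
    ∃ x' g : K, ((∃ h : x' ∈ R i, (⟨x', h⟩ : R i) ∈ P i) ∧ x' ≠ 0 ∧
      ∀ y : R i, y ∈ P i → O.valuation (y : K) ≤ O.valuation x') ∧ g ∈ R i ∧ s i = x' * s (i + 1) + g := by
  obtain ⟨_, _, -, -, h⟩ := hrun.2 i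
  exact h

/-- Members of a steered run contain the `p`-th power of their generator. [folklore] -/
theorem pow_mem_of_run {p : ℕ} (hrun : IsSteeredRun O R P t p s) (i : ℕ) : s i ^ p ∈ R i := by
  obtain ⟨_, h, -⟩ := hrun.2 i
  exact h

/-- Members of a steered run are local. [folklore] -/
theorem isLocalRing_of_run {p : ℕ} (hrun : IsSteeredRun O R P t p s) (i : ℕ) : IsLocalRing (R i) := by
  obtain ⟨h, -⟩ := hrun.2 i
  exact h

/-- Every member of a steered run whose first member is dominated by `O` is dominated by `O`. [folklore] -/
theorem subringDominates_of_run {p : ℕ} (hrun : IsSteeredRun O R P t p s) (hR0 : SubringDominates (R 0) O.toSubring) (i : ℕ) :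
    SubringDominates (R i) O.toSubring :=
  SigmaTopLegality.subringDominates_of_isLocalBlowup O R hR0 (fun i => (isLocalBlowupAlong_of_run hrun i).isLocalBlowup) i

/-! ## §1 (hstart): the clord along the exceptional parameter right after a point step -/

/-- **(hstart).** In a steered run at `p = 2` in characteristic `2` (`R 0` dominated by `O`), let `j` be a POINT step with REGULAR member `R j`,
`x` an exceptional parameter of the step and `ν ≥ 2` the exact cleaned order of the member at `j`. Then the cleaned order of the member ALONG `x`
at stage `j + 1` is EXACTLY `ν − 2`. (res-type-096's (α) `VisitLaw.clord_exc_of_pointStep`, transported to the run words.) [folklore] -/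
theorem hasClordAlongAt_succ_of_pointStep [CharP K 2] (hrun : IsSteeredRun O R P t 2 s) (hR0 : SubringDominates (R 0) O.toSubring)
    {j : ℕ} (hpt : IsPointStep R P j) (hreg : IsRegularLocalRing (R j)) {x : K}
    (hx : (∃ h : x ∈ R j, (⟨x, h⟩ : R j) ∈ P j) ∧ x ≠ 0 ∧ ∀ y : R j, y ∈ P j → O.valuation (y : K) ≤ O.valuation x)
    {ν : ℕ} (hν : 2 ≤ ν) (hclean : HasCleanedOrderAt R s 2 j ν) :
    HasClordAlongAt R s 2 (j + 1) x (ν - 2) := by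
  classical
  haveI : IsLocalRing (R (j + 1)) := isLocalRing_of_run hrun (j + 1)
  obtain ⟨_, hPj⟩ := hpt
  have hblj := isLocalBlowupAlong_of_run hrun j
  have hle : R j ≤ R (j + 1) := hblj.isLocalBlowup.le
  have hbl𝔪 : IsLocalBlowupAlong O (R j) (maximalIdeal (R j)) (R (j + 1)) := by rw [← hPj]; exact hblj
  -- the step at `j`: its own parameter `x'` and cleaner `g₁`
  obtain ⟨x', g₁, hx', hg₁, hstep⟩ := step_of_run hrun j
  obtain ⟨⟨hx'R, hx'P⟩, hx'0, hx'max⟩ := hx'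
  have hx'm : (⟨x', hx'R⟩ : R j) ∈ maximalIdeal (R j) := hPj ▸ hx'P
  have hx'0' : (⟨x', hx'R⟩ : R j) ≠ 0 := fun h => hx'0 (congrArg Subtype.val h)
  have hmin : ∀ y ∈ maximalIdeal (R j), O.valuation (y : K) ≤ O.valuation ((⟨x', hx'R⟩ : R j) : K) :=
    fun y hy => hx'max y (hPj ▸ hy)
  have hS' : R (j + 1) = locAtCentre (blowupRing (R j) x') O :=
    DivisorTrigger.eq_locAtCentre_blowupRing hbl𝔪 hx'R hx'm hx'0 hmin
  have hx'S' : x' ∈ R (j + 1) := hle hx'R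
  -- the cleaned-order datum at `j`
  obtain ⟨_, hsj, ⟨g₀, hg₀⟩, hexact⟩ := hclean
  have hs' : s (j + 1) ^ 2 ∈ R (j + 1) := pow_mem_of_run hrun (j + 1)
  -- the strict-transform law `f'·x'² = f − g₁²` (characteristic `2`)
  have hrel : ((⟨s (j + 1) ^ 2, hs'⟩ : R (j + 1)) : K) * ((⟨x', hx'R⟩ : R j) : K) ^ 2 =
      ((⟨s j ^ 2, hsj⟩ : R j) : K) - ((⟨g₁, hg₁⟩ : R j) : K) ^ 2 := by
    simp only
    rw [hstep]
    have h2 : (2 : K) = 0 := CharTwo.two_eq_zero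
    linear_combination (-(x' * s (j + 1) * g₁)) * h2
  obtain ⟨hex, hmax⟩ := VisitLaw.clord_exc_of_pointStep (subringDominates_of_run hrun hR0 j) hx'm hx'0' hmin hS' hx'S'
    ⟨s j ^ 2, hsj⟩ g₀ ⟨g₁, hg₁⟩ ⟨s (j + 1) ^ 2, hs'⟩ hν hg₀ hexact hrel
  -- clord along `x'` at `j+1` is `ν − 2`
  have hclord' : HasClordAlongAt R s 2 (j + 1) x' (ν - 2) := by
    refine ⟨hx'S', hs', hex, ?_⟩
    rw [show ν - 2 + 1 = ν - 1 by omega]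
    exact hmax
  -- `x = w · x'` with `w` a unit of `R (j+1)`
  obtain ⟨w, hw, hwinv, hxw⟩ := VisitLawTelescope.excParam_eq_unit_mul hblj ⟨⟨hx'R, hx'P⟩, hx'0, hx'max⟩ hx
  have hw0 : w ≠ 0 := fun h => hx.2.1 (by rw [hxw, h, zero_mul])
  exact VisitLawClord.hasClordAlongAt_of_associated hw hwinv hw0 hx'S' hxw hclord'

/-! ## §2 The exceptional parameter is prime in the next (regular) member -/

/-- After a POINT step the exceptional parameter `x` generates the extension of the old maximal ideal to the new member. [folklore] -/
theorem span_image_maximalIdeal_eq {p : ℕ} (hrun : IsSteeredRun O R P t p s) {j : ℕ} [IsLocalRing (R j)]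
    (hPj : P j = maximalIdeal (R j)) {x : K}
    (hx : (∃ h : x ∈ R j, (⟨x, h⟩ : R j) ∈ P j) ∧ x ≠ 0 ∧ ∀ y : R j, y ∈ P j → O.valuation (y : K) ≤ O.valuation x)
    (hle : R j ≤ R (j + 1)) (hx1 : x ∈ R (j + 1)) :
    Ideal.span ((fun y : R j => (⟨(y : K), hle y.2⟩ : R (j + 1))) '' (maximalIdeal (R j) : Set (R j))) =
      Ideal.span {(⟨x, hx1⟩ : R (j + 1))} := by
  obtain ⟨⟨hxR, hxP⟩, hx0, hxmax⟩ := hx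
  have hdiv := GeoDict.exists_mem_mul_of_isExcParamAlong (isLocalBlowupAlong_of_run hrun j) ⟨hxR, hxP⟩ hx0 hxmax
  apply le_antisymm
  · refine Ideal.span_le.mpr ?_
    rintro _ ⟨y, hy, rfl⟩
    obtain ⟨r, hr, hyr⟩ := hdiv y (hPj ▸ hy)
    refine Ideal.mem_span_singleton'.mpr ⟨⟨r, hr⟩, Subtype.ext ?_⟩
    simp only [Subring.coe_mul]
    exact hyr.symm
  · rw [Ideal.span_singleton_le_iff_mem]
    exact Ideal.subset_span ⟨⟨x, hxR⟩, hPj ▸ hxP, rfl⟩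

/-- **The exceptional parameter is PRIME in the next member.** In a steered run (`R 0` dominated by `O`), at a POINT step `j` between REGULAR members
`R j`, `R (j+1)`, an exceptional parameter `x` of the step lies in `𝔪 ∖ 𝔪²` of `R (j+1)` (`CleaningOptimal.excParam_mem_and_not_mem_sq`), hence is
prime there. [folklore] -/
theorem prime_excParam_succ {p : ℕ} (hrun : IsSteeredRun O R P t p s) (hR0 : SubringDominates (R 0) O.toSubring)
    {j : ℕ} (hpt : IsPointStep R P j) (hreg : IsRegularLocalRing (R j)) (hreg' : IsRegularLocalRing (R (j + 1))) {x : K}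
    (hx : (∃ h : x ∈ R j, (⟨x, h⟩ : R j) ∈ P j) ∧ x ≠ 0 ∧ ∀ y : R j, y ∈ P j → O.valuation (y : K) ≤ O.valuation x)
    (hx1 : x ∈ R (j + 1)) :
    (⟨x, hx1⟩ : R (j + 1)) ∈ maximalIdeal (R (j + 1)) ∧ (⟨x, hx1⟩ : R (j + 1)) ∉ maximalIdeal (R (j + 1)) ^ 2 ∧
      Prime (⟨x, hx1⟩ : R (j + 1)) := by
  classical
  obtain ⟨_, hPj⟩ := hpt
  have hblj := isLocalBlowupAlong_of_run hrun j
  have hle : R j ≤ R (j + 1) := hblj.isLocalBlowup.le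
  have hbl𝔪 : IsLocalBlowupAlong O (R j) (maximalIdeal (R j)) (R (j + 1)) := by rw [← hPj]; exact hblj
  have hQTA : IsQuadraticTransformAlong O (R j) (R (j + 1)) := ⟨inferInstance, hbl𝔪⟩
  have hQT := hQTA.isQuadraticTransform (subringDominates_of_run hrun hR0 j)
  have hspan := span_image_maximalIdeal_eq hrun hPj hx hle hx1
  obtain ⟨hm, hm2⟩ := CleaningOptimal.excParam_mem_and_not_mem_sq hreg hreg' hQT hle ⟨x, hx1⟩ hspan
  have hx0 : (⟨x, hx1⟩ : R (j + 1)) ≠ 0 := fun h => hx.2.1 (congrArg Subtype.val h)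
  exact ⟨hm, hm2, (Ideal.span_singleton_prime hx0).mp (SigmaTopLegality.isPrime_span_singleton_of_not_mem_sq (R (j + 1)) hm hm2)⟩

/-! ## §3 Weak strip legality is free -/

/-- **A strip along `(x)` sees `f − g² ∈ (x)²`.** At a NON-point step `k` of a steered run at `p = 2` whose centre is `P k = (x)`, the σ_top centre is
permissible, so some cleaning puts the member into `(x)²`; hence every clord along `x` at `k` is `≥ 2`. [folklore] -/
theorem two_le_clord_of_strip (hrun : IsSteeredRun O R P t 2 s) {k : ℕ} (hnpt : ¬ IsPointStep R P k) {x : K}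
    (hxk : x ∈ R k) (hPk : P k = Ideal.span {(⟨x, hxk⟩ : R k)}) {n : ℕ} (hn : HasClordAlongAt R s 2 k x n) : 2 ≤ n := by
  obtain ⟨_, hs, hcentre, -, -⟩ := hrun.2 k
  -- the centre is permissible (not the closed point)
  have hperm : ∃ g : R k, (⟨s k ^ 2, hs⟩ : R k) - g ^ 2 ∈ P k ^ 2 := by
    rcases hcentre with hperm | ⟨hPm, -, -⟩
    · exact hperm.2.2.2
    · exact absurd ⟨‹_›, hPm⟩ hnpt
  obtain ⟨g, hg⟩ := hperm
  rw [hPk, Ideal.span_singleton_pow] at hg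
  obtain ⟨_, _, -, hmax⟩ := hn
  by_contra hlt
  refine hmax g (Ideal.span_singleton_le_span_singleton.mpr ?_ hg)
  exact pow_dvd_pow _ (by omega)

/-- **Weak strip legality between two visits.** Under Hγ «every step strictly between `j` and `j′` is the strip along `(x)`», every clord along `x`
strictly between is `≥ 2`. (The `hlegal` input of `VisitLawClord.clord_at_visit`.) [folklore] -/
theorem two_le_clord_between (hrun : IsSteeredRun O R P t 2 s) {j j' : ℕ} (hvisit : IsVisitPair R P j j') {x : K}
    (Hγ : ∀ k, j < k → k < j' → ∃ hx : x ∈ R k, P k = Ideal.span {(⟨x, hx⟩ : R k)}) :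
    ∀ k, j < k → k < j' → ∀ n, HasClordAlongAt R s 2 k x n → 2 ≤ n := by
  intro k hjk hkj' n hn
  obtain ⟨hxk, hPk⟩ := Hγ k hjk hkj'
  exact two_le_clord_of_strip hrun (hvisit.2.2.2 k hjk hkj') hxk hPk hn

/-! ## §4 The repaired visit law with the count -/

/-- **FILE 2b — the repaired one-step law between two visits, with the count `j′ − j = ν / 2`.** Steered run at `p = 2` in characteristic `2`, `R 0`
dominated by `O`; `(j, j′)` a visit pair with Hγ «only `x`-strips strictly between»; `x` an exceptional parameter of the point step `j`; the members
`R j`, `R (j+1)` regular; `ν ≥ 2` the exact cleaned order at `j`; (δ) at the point step `j′` every clord along `x` is `≤ 1`. Then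
(1) `R j′ = R (j+1)`; (2) `s j′ · x ^ (ν/2) · W = s j − G` for some `G, W ∈ R j′` with `W⁻¹ ∈ R j′`, `W ≠ 0` (plan-1 RULING 145 R1: unit cofactor);
(count) `j′ − j = ν / 2`; (3)/(4) the clord along `x` at `j′` is EXACTLY `ν % 2`. [folklore] -/
theorem visitLaw₂_of_pieces [CharP K 2] (hrun : IsSteeredRun O R P t 2 s) (hR0 : SubringDominates (R 0) O.toSubring)
    {j j' : ℕ} (hvisit : IsVisitPair R P j j') {x : K}
    (hx : (∃ h : x ∈ R j, (⟨x, h⟩ : R j) ∈ P j) ∧ x ≠ 0 ∧ ∀ y : R j, y ∈ P j → O.valuation (y : K) ≤ O.valuation x)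
    (Hγ : ∀ k, j < k → k < j' → ∃ hx : x ∈ R k, P k = Ideal.span {(⟨x, hx⟩ : R k)})
    (hreg : IsRegularLocalRing (R j)) (hreg' : IsRegularLocalRing (R (j + 1)))
    {ν : ℕ} (hν : 2 ≤ ν) (hclean : HasCleanedOrderAt R s 2 j ν)
    (hδ : ∀ n, HasClordAlongAt R s 2 j' x n → n ≤ 1) :
    (R j' = R (j + 1) ∧ ∃ G W : K, G ∈ R j' ∧ W ∈ R j' ∧ W⁻¹ ∈ R j' ∧ W ≠ 0 ∧ s j' * x ^ (ν / 2) * W = s j - G) ∧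
      j' - j = ν / 2 ∧ HasClordAlongAt R s 2 j' x (ν % 2) := by
  have hpt : IsPointStep R P j := hvisit.2.1
  have hx1 : x ∈ R (j + 1) := (isLocalBlowupAlong_of_run hrun j).isLocalBlowup.le hx.1.fst
  have hxprime := (prime_excParam_succ hrun hR0 hpt hreg hreg' hx hx1).2.2
  have hstart := hasClordAlongAt_succ_of_pointStep hrun hR0 hpt hreg hx hν hclean
  obtain ⟨hcount, hres⟩ := VisitLawClord.clord_at_visit hrun hR0 hvisit.1 Hγ hx1 hxprime
    (two_le_clord_between hrun hvisit Hγ) hν hstart hδ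
  obtain ⟨hR, G, W, hG, hW, hWinv, hW0, hlaw⟩ := VisitLawTelescope.visitLaw_telescope_of_isVisitPair hrun hR0 hvisit hx Hγ
  rw [hcount] at hlaw
  exact ⟨⟨hR, G, W, hG, hW, hWinv, hW0, hlaw⟩, hcount, hres⟩

end VisitLawPointStep

end Summit.ResolutionOfSingularities.ResolutionOfSingularities.Theorems.SwitchingDichotomy
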